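import Mathlib
import Literature.Analysis.FunctionSpaces.BochnerProofs
import HarnessLib

/-!
# Bochner's theorem for real, even positive-definite functions, and Fourier positivity of measures

Two corollaries of Bochner's theorem (`Literature.Analysis.FunctionSpaces.bochner_holds`, Bochner 1933 Satz 22) on a
finite-dimensional real inner product space `V`, in the REAL form in which reflection positivity delivers positive
definiteness (`∑ᵢⱼ cᵢ cⱼ φ(zᵢ − zⱼ) ≥ 0` for real `cᵢ`, written out; no definition is introduced):

* `exists_finiteMeasure_charFun_eq_of_realPosDef` — a continuous, even, real positive-definite `φ : V → ℝ` is the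
  characteristic function of a FINITE positive measure `m` (`charFun m z = φ z`; mass `φ 0`; in particular
  `φ z = ∫ cos ⟪q, z⟫ dm(q)`): real PD + evenness ⇒ complex PD (`isPositiveDefinite_ofReal_of_realPosDef`), normalise by
  `φ 0` (`|φ| ≤ φ 0`, `abs_le_apply_zero_of_realPosDef`; `φ 0 = 0` forces `φ = 0`), apply Bochner, rescale
  [cite: Bochner1933, Satz 22];
* `exists_finiteMeasure_eq_add_of_charFun_sub_realPosDef` — FOURIER POSITIVITY: if the difference of the characteristic
  functions of two finite measures is a real positive-definite function, the measures are ordered: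
  `m₁ = m₂ + π` for a finite positive `π` (Bochner for the difference, then Lévy uniqueness `Measure.ext_of_charFun`)
  [cite: Bochner1933, Satz 22].

THEOREMS ONLY; Mathlib + tree; no `sorry`; standard axioms.  Motivation in the tree: the transverse (`z⃗`) structure of the
Laplace–Fourier measure of a reflection-positive two-point kernel (crux ⟨stmt-QuantumFields-23125⟩, LINE g18-A stub
`stub_laplaceFourier`): Bochner slices `t ↦ m_t` of the kernel, and the passage from scalar to measure-valued complete
monotonicity.
-/

noncomputable section

open MeasureTheory Complex
open scoped ComplexConjugate InnerProductSpace NNReal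

namespace Literature.Analysis.FunctionSpaces

/-! ### Real positive-definite even functions -/

section RealPosDef

variable {V : Type*} [AddCommGroup V]

/-- A real positive-definite even function is bounded by its value at `0`: `|φ z| ≤ φ 0` (the `2 × 2` Gram matrices
at `{0, z}` with coefficients `(1, ±1)`; Gel'fand–Vilenkin IV, Ch. II §3.1 property 3). [cite: Bochner1933, §1] -/
theorem abs_le_apply_zero_of_realPosDef (φ : V → ℝ)
    (hPD : ∀ (m : ℕ) (z : Fin m → V) (c : Fin m → ℝ), 0 ≤ ∑ i, ∑ j, c i * c j * φ (z i - z j))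
    (heven : ∀ z, φ (-z) = φ z) (z : V) : |φ z| ≤ φ 0 := by
  have key : ∀ ε : ℝ, ε = 1 ∨ ε = -1 → 0 ≤ 2 * φ 0 + 2 * ε * φ z := by
    intro ε hε
    have hε2 : ε * ε = 1 := by rcases hε with rfl | rfl <;> norm_num
    have h := hPD 2 ![z, 0] ![1, ε]
    simp only [Fin.sum_univ_two, Matrix.cons_val_zero, Matrix.cons_val_one, sub_self,
      sub_zero, zero_sub, heven] at h
    have e2 : ε * ε * φ 0 = φ 0 := by rw [hε2, one_mul]
    linarith
  have h1 := key 1 (Or.inl rfl)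
  have h2 := key (-1) (Or.inr rfl)
  rw [abs_le]; constructor <;> linarith

/-- `φ 0 ≥ 0` for a real positive-definite function (Gel'fand–Vilenkin IV, Ch. II §3.1 property 1). [cite: Bochner1933, §1] -/
theorem apply_zero_nonneg_of_realPosDef (φ : V → ℝ)
    (hPD : ∀ (m : ℕ) (z : Fin m → V) (c : Fin m → ℝ), 0 ≤ ∑ i, ∑ j, c i * c j * φ (z i - z j)) : 0 ≤ φ 0 := by
  have h := hPD 1 ![0] ![1]
  simpa using h

/-- **Real PD + even ⇒ complex PD**: for `φ : V → ℝ` even with `∑ cᵢcⱼ φ(zᵢ − zⱼ) ≥ 0` for real coefficients,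
`z ↦ (φ z : ℂ)` is positive definite in the Hermitian sense of `IsPositiveDefinite` (real and imaginary parts of the
coefficients separately; the cross term vanishes by symmetry of the kernel) — a real symmetric kernel is positive
definite over `ℝ` iff over `ℂ`. [cite: BergChristensenRessel1984, Ch. 3 §1] -/
theorem isPositiveDefinite_ofReal_of_realPosDef (φ : V → ℝ)
    (hPD : ∀ (m : ℕ) (z : Fin m → V) (c : Fin m → ℝ), 0 ≤ ∑ i, ∑ j, c i * c j * φ (z i - z j))
    (heven : ∀ z, φ (-z) = φ z) : IsPositiveDefinite (fun z => ((φ z : ℝ) : ℂ)) := by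
  intro m x c
  have hsym : ∀ i j, φ (x j - x i) = φ (x i - x j) := fun i j => by rw [← heven, neg_sub]
  have hre : (∑ i, ∑ j, conj (c i) * c j * ((φ (x j - x i) : ℝ) : ℂ)).re =
      (∑ i, ∑ j, (c i).re * (c j).re * φ (x i - x j)) + ∑ i, ∑ j, (c i).im * (c j).im * φ (x i - x j) := by
    rw [Complex.re_sum, ← Finset.sum_add_distrib]
    refine Finset.sum_congr rfl fun i _ => ?_
    rw [Complex.re_sum, ← Finset.sum_add_distrib]
    refine Finset.sum_congr rfl fun j _ => ?_
    rw [hsym]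
    simp only [Complex.mul_re, Complex.mul_im, Complex.conj_re, Complex.conj_im, Complex.ofReal_re,
      Complex.ofReal_im]
    ring
  have him : (∑ i, ∑ j, conj (c i) * c j * ((φ (x j - x i) : ℝ) : ℂ)).im =
      ∑ i, ∑ j, ((c i).re * (c j).im - (c i).im * (c j).re) * φ (x i - x j) := by
    rw [Complex.im_sum]
    refine Finset.sum_congr rfl fun i _ => ?_
    rw [Complex.im_sum]
    refine Finset.sum_congr rfl fun j _ => ?_
    rw [hsym]
    simp only [Complex.mul_re, Complex.mul_im, Complex.conj_re, Complex.conj_im, Complex.ofReal_re,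
      Complex.ofReal_im]
    ring
  have hanti : ∑ i, ∑ j, ((c i).re * (c j).im - (c i).im * (c j).re) * φ (x i - x j) = 0 := by
    have hswap : ∑ i, ∑ j, ((c i).re * (c j).im - (c i).im * (c j).re) * φ (x i - x j) =
        -∑ i, ∑ j, ((c i).re * (c j).im - (c i).im * (c j).re) * φ (x i - x j) := by
      conv_lhs => rw [Finset.sum_comm]
      rw [← Finset.sum_neg_distrib]
      refine Finset.sum_congr rfl fun i _ => ?_
      rw [← Finset.sum_neg_distrib]
      refine Finset.sum_congr rfl fun j _ => ?_
      rw [← hsym i j]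
      ring
    linarith
  refine ⟨?_, ?_⟩
  · rw [hre]
    exact add_nonneg (hPD m x (fun i => (c i).re)) (hPD m x (fun i => (c i).im))
  · rw [him, hanti]

end RealPosDef

section Bochner

variable {V : Type*} [NormedAddCommGroup V] [InnerProductSpace ℝ V] [FiniteDimensional ℝ V]
  [MeasurableSpace V] [BorelSpace V]

/-- **Bochner's theorem, real even form.**  A continuous, even, real positive-definite `φ : V → ℝ` on a
finite-dimensional real inner product space is the characteristic function of a finite positive measure:
`charFun m z = φ z` for all `z` (so `φ z = ∫ cos ⟪q, z⟫ dm(q)` and `m(V) = φ 0`). [cite: Bochner1933, Satz 22] -/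
theorem exists_finiteMeasure_charFun_eq_of_realPosDef (φ : V → ℝ) (hc : Continuous φ)
    (hPD : ∀ (m : ℕ) (z : Fin m → V) (c : Fin m → ℝ), 0 ≤ ∑ i, ∑ j, c i * c j * φ (z i - z j))
    (heven : ∀ z, φ (-z) = φ z) :
    ∃ m : Measure V, IsFiniteMeasure m ∧ ∀ z, charFun m z = φ z := by
  have h0 := apply_zero_nonneg_of_realPosDef φ hPD
  rcases h0.eq_or_lt with h00 | h0pos
  · -- `φ 0 = 0`: then `φ = 0` and the zero measure represents it
    refine ⟨0, inferInstance, fun z => ?_⟩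
    have hz : φ z = 0 := by
      have := abs_le_apply_zero_of_realPosDef φ hPD heven z
      rw [← h00] at this
      exact abs_eq_zero.1 (le_antisymm this (abs_nonneg _))
    rw [charFun_zero_measure, hz, Complex.ofReal_zero]
  · -- normalise and apply Bochner
    set ψ : V → ℝ := fun z => φ z / φ 0 with hψ
    have hψPD : ∀ (m : ℕ) (z : Fin m → V) (c : Fin m → ℝ), 0 ≤ ∑ i, ∑ j, c i * c j * ψ (z i - z j) := by
      intro m z c
      have h := hPD m z c
      have e : ∑ i, ∑ j, c i * c j * ψ (z i - z j) = (∑ i, ∑ j, c i * c j * φ (z i - z j)) / φ 0 := by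
        rw [Finset.sum_div]
        refine Finset.sum_congr rfl fun i _ => ?_
        rw [Finset.sum_div]
        refine Finset.sum_congr rfl fun j _ => ?_
        rw [hψ]; ring
      rw [e]; exact div_nonneg h h0pos.le
    have hψeven : ∀ z, ψ (-z) = ψ z := fun z => by simp only [hψ, heven]
    have hC : Continuous fun z => ((ψ z : ℝ) : ℂ) := Complex.continuous_ofReal.comp (hc.div_const _)
    have hP : IsPositiveDefinite fun z => ((ψ z : ℝ) : ℂ) := isPositiveDefinite_ofReal_of_realPosDef ψ hψPD hψeven
    have h1 : ((ψ 0 : ℝ) : ℂ) = 1 := by rw [hψ]; simp [div_self h0pos.ne']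
    have hb : ∃! μ : Measure V, IsProbabilityMeasure μ ∧ charFun μ = fun z => ((ψ z : ℝ) : ℂ) :=
      bochner_holds (V := V) (fun z => ((ψ z : ℝ) : ℂ)) hC hP h1
    obtain ⟨μ, ⟨hμP, hμC⟩, -⟩ := hb
    refine ⟨(φ 0).toNNReal • μ, inferInstance, fun z => ?_⟩
    have hcz := congrFun hμC z
    rw [charFun_apply] at hcz ⊢
    rw [integral_smul_nnreal_measure, hcz, hψ]
    simp only
    rw [NNReal.smul_def, Real.coe_toNNReal _ h0pos.le, Complex.real_smul, ← Complex.ofReal_mul]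
    congr 1
    field_simp

/-- `charFun (μ + ν) = charFun μ + charFun ν` for finite measures. [folklore] -/
private theorem charFun_add_measure (μ ν : Measure V) [IsFiniteMeasure μ] [IsFiniteMeasure ν] (z : V) :
    charFun (μ + ν) z = charFun μ z + charFun ν z := by
  simp only [charFun_apply]
  have hint : ∀ (ρ : Measure V) [IsFiniteMeasure ρ], Integrable (fun x : V => Complex.exp (⟪x, z⟫_ℝ * I)) ρ := by
    intro ρ _
    refine (integrable_const (1 : ℝ)).mono' (by fun_prop) (ae_of_all _ fun x => ?_)
    rw [Complex.norm_exp_ofReal_mul_I]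
  rw [integral_add_measure (hint μ) (hint ν)]

/-- **Fourier positivity**: if the characteristic functions of two finite measures `m₁, m₂` differ by a real
positive-definite function, `charFun m₁ z − charFun m₂ z = ψ z` with `∑ cᵢcⱼ ψ(zᵢ − zⱼ) ≥ 0`, then `m₂ ≤ m₁` in the strong
sense `m₁ = m₂ + π` for a finite positive measure `π` (Bochner for `ψ`, uniqueness of the Fourier transform).
[cite: Bochner1933, Satz 22] -/
theorem exists_finiteMeasure_eq_add_of_charFun_sub_realPosDef {m₁ m₂ : Measure V} [IsFiniteMeasure m₁]
    [IsFiniteMeasure m₂] (ψ : V → ℝ) (hψ : ∀ z, charFun m₁ z - charFun m₂ z = ψ z)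
    (hPD : ∀ (m : ℕ) (z : Fin m → V) (c : Fin m → ℝ), 0 ≤ ∑ i, ∑ j, c i * c j * ψ (z i - z j)) :
    ∃ π : Measure V, IsFiniteMeasure π ∧ m₁ = m₂ + π := by
  haveI : CompleteSpace V := FiniteDimensional.complete ℝ V
  -- `ψ` is continuous and even
  have hψ' : ∀ z, ψ z = (charFun m₁ z - charFun m₂ z).re := fun z => by
    rw [hψ z, Complex.ofReal_re]
  have hc : Continuous ψ := by
    have : ψ = fun z => (charFun m₁ z - charFun m₂ z).re := funext hψ'
    rw [this]
    exact Complex.continuous_re.comp ((continuous_charFun (μ := m₁)).sub (continuous_charFun (μ := m₂)))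
  have heven : ∀ z, ψ (-z) = ψ z := by
    intro z
    apply Complex.ofReal_injective
    rw [← hψ, ← hψ, charFun_neg, charFun_neg, ← map_sub, hψ, Complex.conj_ofReal]
  obtain ⟨π, hπ, hπC⟩ := exists_finiteMeasure_charFun_eq_of_realPosDef ψ hc hPD heven
  refine ⟨π, hπ, Measure.ext_of_charFun (funext fun z => ?_)⟩
  rw [charFun_add_measure, hπC, ← hψ]
  ring

end Bochner

end Literature.Analysis.FunctionSpaces

end
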